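import Mathlib
import Summits.KontsevichZagierPeriods.Zeta5Search.UniversalDigit
import Summits.KontsevichZagierPeriods.Zeta5Search.RayAtlasCellsX
import HarnessLib

/-!
# ζ(5) search — the CLASSWISE SECOND-DIGIT LEMMA and THEOREM A‴ (second-order collinearity), statement layer (gen-2 g10)

Cell `pub-zeta5` (HONEST FRAMING: systematic search; no irrationality claim unless certified), ideation seat gen-2, generation 10
(`HOME/pub-zeta5-gen-2/REPORT-gen2-g10.md` §1–§3).  STATEMENTS ONLY (`@[conjecture] def … : Prop`), all PROVED ON PAPER in REPORT-gen2-g10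
(elementary: the exact change of variables `y = −x − pη` of Theorem B carried to SECOND order) and exact-checked (`g10/secdigit.py`: 123,662 pole
classes, 0 failures; `g10/lawA2.py`: random census + the X-ray zero cells, 0 failures).  Nothing here bears on irrationality: these are `p`-adic
digits of the partial-fraction data of the Brown–Zudilin rational function `R_b` and the resulting valuation bonus of the contiguity Casoratian.

Notation as in `ClusterValuation` / `UniversalDigit`: positions `q ∈ [0,b₀]`, class `classSet b p x` with base `x < p` (level 0), level `ℓ_q = q / p`,
top level `L = (b₀ − x)/p`, `E_x = classExp`, `ρ_{q,σ} = classRho`, `ĝ_q = gHat`, `ŵ_x = wHat`, `v̂_x = vHat`, `V_x = classV`, `W_x = Σ_{s ∈ class} c_{2,s}`.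
NEW class invariants:
* `φ_x = phiHat b p x := Σ_{s ∉ class} netExp(s)/(s − x)` (+ `1/(b₀/2 − x)` for the odd centre outside the class) — `p`-integral, class-constant mod `p`,
  ODD under conjugation; it is the `u¹`-coefficient of the foreign factor: `ĝ_{x+ℓp} ≡ ĝ_x (1 − ℓ p φ_x) (mod p²)`;
* the functionals of `ηΦ_x` (use `ρ[ηΦ]_{ℓ,σ} = ℓρ_{ℓ,σ} + ρ_{ℓ,σ+1}`): `ŵ₂_x = wHat2 := Σ_{poles} (ℓ_q ρ_{q,3} + ρ_{q,4})`,
  `v̂₂_x = vHat2 := Σ_{poles} Σ_σ (−1)^σ (ℓ_q ρ_{q,σ} + ρ_{q,σ+1}) H^{(σ)}_{ℓ_q}`;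
* `τ_x := (2ŵ₂ − Lŵ, 2v̂₂ − Lv̂)` = the functionals of `(2η − L)Φ_x` (`tauW`, `tauV`);
* the TYPE LIST `classTypeList b p x = [netExp(x), netExp(x+p), …, netExp(x+Lp)]` (neutral points included) and single RAISES of a list (`isRaise`, Boolean).
-/

open Finset

namespace Summit.KontsevichZagierPeriods.Zeta5Search.SecondOrder

open Summit.KontsevichZagierPeriods.Zeta5Search.ClusterValuation
open Summit.KontsevichZagierPeriods.Zeta5Search.WedgeDictionary (pfData dOf)
open Summit.KontsevichZagierPeriods.Zeta5Search.CasoratianValuation (InPolytope shift casoratian)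
open Summit.KontsevichZagierPeriods.Zeta5Search.RayAtlas (bX1Ray bX2Ray bX3Ray)
open Literature.NumberTheory.Transcendental.BallRivoal (harm)

/-! ## §1 New class invariants -/

/-- `φ_x := Σ_{s ∉ class(x)} netExp(s)/(s − x)` (+ the odd centre outside the class): the logarithmic derivative at the base of the foreign factor. -/
def phiHat (b : ℕ → ℤ) (p x : ℕ) : ℚ :=
  (∑ s ∈ (range ((b 0).toNat + 1)).filter (fun s => s % p ≠ x % p), (netExp b s : ℚ) / ((s : ℚ) - x))
    + (if ¬ (2 : ℤ) ∣ b 0 ∧ ¬ CentreIn b p x then 1 / ((b 0 : ℚ) / 2 - x) else 0)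

/-- `ŵ₂_x := Σ_{poles q} (ℓ_q ρ_{q,3} [n_q ≥ 3] + ρ_{q,4} [n_q ≥ 4])` = `ŵ[ηΦ_x]`. -/
noncomputable def wHat2 (b : ℕ → ℤ) (p x : ℕ) : ℚ :=
  ∑ q ∈ classPoles b p x,
    ((if netExp b q ≤ -3 then ((q / p : ℕ) : ℚ) * classRho b p q 3 else 0)
      + (if netExp b q ≤ -4 then classRho b p q 4 else 0))

/-- `v̂₂_x := Σ_{poles q} Σ_{σ=1}^{n_q} (−1)^σ (ℓ_q ρ_{q,σ} + ρ_{q,σ+1}[σ+1 ≤ n_q]) H^{(σ)}_{ℓ_q}` = `v̂[ηΦ_x]`. -/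
noncomputable def vHat2 (b : ℕ → ℤ) (p x : ℕ) : ℚ :=
  ∑ q ∈ classPoles b p x, ∑ σ ∈ Icc 1 (-netExp b q).toNat,
    (-1 : ℚ) ^ σ * (((q / p : ℕ) : ℚ) * classRho b p q σ
        + (if (σ : ℤ) + 1 ≤ -netExp b q then classRho b p q (σ + 1) else 0)) * harm σ (q / p)

/-- Top level `L = (b₀ − x)/p` of the class with base `x < p`. -/
def topLevel (b : ℕ → ℤ) (p x : ℕ) : ℕ := ((b 0).toNat - x) / p

/-- First component of `τ_x = σ[(2η − L)Φ_x]`: `2ŵ₂ − Lŵ`. -/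
noncomputable def tauW (b : ℕ → ℤ) (p x : ℕ) : ℚ := 2 * wHat2 b p x - (topLevel b p x : ℚ) * wHat b p x
/-- Second component of `τ_x`: `2v̂₂ − Lv̂`. -/
noncomputable def tauV (b : ℕ → ℤ) (p x : ℕ) : ℚ := 2 * vHat2 b p x - (topLevel b p x : ℚ) * vHat b p x

/-- The TYPE LIST of the class with base `x`: net exponents along the levels `0..L` (neutral points included; the odd centre's `+1`, at a
half-integer level, is NOT in the list — it is recorded by `CentreIn`). -/
def classTypeList (b : ℕ → ℤ) (p x : ℕ) : List ℤ :=
  (List.range (topLevel b p x + 1)).map fun ℓ => netExp b (x + ℓ * p)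

/-- `S` is a SINGLE RAISE of `T`: `T` with one entry increased by `1` (any position, neutral entries included), or `T` extended by ONE new end
entry equal to `1` (REPORT-gen2-g10 §2.2; g9's corrected `raises*`). -/
def isRaise (T S : List ℤ) : Bool :=
  ((List.range T.length).any fun k => S == T.mapIdx fun i e => if i = k then e + 1 else e) || S == 1 :: T || S == T ++ [1]

/-! ## §2 The classwise second-digit lemma (REPORT-gen2-g10 §1; PROVED on paper; exact check 123,662 classes, 0 failures) -/

/-- **(W2) second digit of the `W`-row.** With the base unit `ĝ_x` (`x < p` the least class point):
`W_x ≡ (−p)^{E+3} ĝ_x (ŵ_x − p φ_x ŵ₂_x)  (mod p^{E+5})`. -/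
@[conjecture] def SecondDigitW : Prop :=
  ∀ (b : ℕ → ℤ) (p x : ℕ), InPolytope b → p.Prime → 5 ≤ p → (b 0 + 2 : ℤ) < (p : ℤ) ^ 2 → x < p → 1 ≤ classPoleCount b p x →
    (∑ s ∈ classSet b p x, pfData b 2 s)
        - (-(p : ℚ)) ^ (classExp b p x + 3) * gHat b p x * (wHat b p x - (p : ℚ) * phiHat b p x * wHat2 b p x) ≠ 0 →
      classExp b p x + 5 ≤
        padicValRat p ((∑ s ∈ classSet b p x, pfData b 2 s)
          - (-(p : ℚ)) ^ (classExp b p x + 3) * gHat b p x * (wHat b p x - (p : ℚ) * phiHat b p x * wHat2 b p x))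

/-- **(V2) second digit of `V_x` (`E_x ≤ −2`, so that the residue sum `Σρ₁` vanishes):**
`V_x ≡ (−p)^{E} ĝ_x (v̂_x − p φ_x v̂₂_x)  (mod p^{E+2})`. -/
@[conjecture] def SecondDigitV : Prop :=
  ∀ (b : ℕ → ℤ) (p x : ℕ), InPolytope b → p.Prime → 5 ≤ p → (b 0 + 2 : ℤ) < (p : ℤ) ^ 2 → x < p → 1 ≤ classPoleCount b p x →
    classExp b p x ≤ -2 →
    classV b p x - (-(p : ℚ)) ^ (classExp b p x) * gHat b p x * (vHat b p x - (p : ℚ) * phiHat b p x * vHat2 b p x) ≠ 0 →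
      classExp b p x + 2 ≤
        padicValRat p (classV b p x
          - (-(p : ℚ)) ^ (classExp b p x) * gHat b p x * (vHat b p x - (p : ℚ) * phiHat b p x * vHat2 b p x))

/-! ## §3 THEOREM A‴ — one palindromic deep type + single raises ⇒ three digits (REPORT-gen2-g10 §3; PROVED on paper)

General form (REPORT §3, criterion C2*): if every deep class (exponent `m`, even, `≤ −6`) is a non-self-conjugate palindrome and the vectors
`τ_x` (deep `x`) and the sub-deep orbit vectors (`(ŵ,v̂)`-orbit sums at exponent `m+1`) span a line mod `p`, then `v_p(Cas_j) ≥ 6 + 2m = casLB + 3`.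
Recorded here in the combinatorial special case that covers every zero cell of the atlas (the RAISE LEMMA makes all those vectors equal to `τ(T)`):
the hypotheses below are g9's CANDIDATE LAW A′ with ONE deep type; A′ is thereby proved in that form (random exact census: C2* ⇒ excess ≥ 3 in
all instances; A′-hypotheses ⊂ C2* in all instances). -/

/-- **THEOREM A‴ (one-type form).**  Window prime `5 ≤ p ≤ b₀ < p² − 2`; `M ≥ 6` even with every multipole class exponent `≥ −M` and every
single-pole class `ν ≥ −M+1` (regime H0); every class of exponent `−M` is non-self-conjugate with type list `T`, `T` a palindrome; every pole
class with `ν = −M+1` has a type list that is a single raise of `T`, or is the odd-centre class of type `T`.  Then `v_p(Cas_j(b)) ≥ 6 − 2M`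
for every admissible direction `j`. -/
@[conjecture] def LawA3 : Prop :=
  ∀ (b : ℕ → ℤ) (p j M : ℕ) (T : List ℤ), InPolytope b → InPolytope (shift b j) → 1 ≤ j → j ≤ 7 → p.Prime → 5 ≤ p → (p : ℤ) ≤ b 0 →
    (b 0 + 2 : ℤ) < (p : ℤ) ^ 2 → 6 ≤ M → Even M → T.reverse = T →
    (∀ x ∈ multipoleClasses b p, -(M : ℤ) ≤ classExp b p x) →
    (∀ y, y < p → classPoleCount b p y = 1 → -(M : ℤ) + 1 ≤ classNu b p y) →
    (∀ x ∈ multipoleClasses b p, classExp b p x = -(M : ℤ) → ¬ CentreIn b p x ∧ classTypeList b p x = T) →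
    (∀ y, y < p → 1 ≤ classPoleCount b p y → classNu b p y = -(M : ℤ) + 1 →
        isRaise T (classTypeList b p y) = true ∨ (¬ (2 : ℤ) ∣ b 0 ∧ CentreIn b p y ∧ classTypeList b p y = T)) →
    casoratian b j ≠ 0 → (6 : ℤ) - 2 * M ≤ padicValRat p (casoratian b j)

/-- The SUB-DEEP ORBIT VECTOR of the pole class `y` (first-digit functionals `(ŵ, v̂)`, each class with its own base): `σ_y` for a self-conjugate
class (`CentreIn`), `σ_y + σ_ȳ` for a conjugate pair, `ȳ = (b₀ − y) mod p` (the unit weights `ĝ_y ≡ ĝ_ȳ (mod p)` at odd exponent drop out of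
the direction). -/
noncomputable def orbitW (b : ℕ → ℤ) (p y : ℕ) : ℚ :=
  if CentreIn b p y then wHat b p y else wHat b p y + wHat b p (((b 0).toNat - y) % p)
/-- Second component of the sub-deep orbit vector. -/
noncomputable def orbitV (b : ℕ → ℤ) (p y : ℕ) : ℚ :=
  if CentreIn b p y then vHat b p y else vHat b p y + vHat b p (((b 0).toNat - y) % p)

/-- **THEOREM A‴ (general form, criterion C2*; REPORT-gen2-g10 §3, PROVED on paper).**  Regime as in `LawA3`; every class of exponent `−M` is a
non-self-conjugate class with PALINDROMIC type list; and the second-order directions — `τ_x` for the deep classes `x`, the orbit vectors of the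
pole classes with `ν = −M+1` — are pairwise collinear mod `p` (cross products `≡ 0`).  Then `v_p(Cas_j(b)) ≥ 6 − 2M = casLB + 3`.  (`LawA3` is the case in which the RAISE
LEMMA makes every direction equal to `τ(T)`.) -/
@[conjecture] def SecondOrderCollinearity : Prop :=
  ∀ (b : ℕ → ℤ) (p j M : ℕ), InPolytope b → InPolytope (shift b j) → 1 ≤ j → j ≤ 7 → p.Prime → 5 ≤ p → (p : ℤ) ≤ b 0 →
    (b 0 + 2 : ℤ) < (p : ℤ) ^ 2 → 6 ≤ M → Even M →
    (∀ x ∈ multipoleClasses b p, -(M : ℤ) ≤ classExp b p x) →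
    (∀ y, y < p → classPoleCount b p y = 1 → -(M : ℤ) + 1 ≤ classNu b p y) →
    (∀ x ∈ multipoleClasses b p, classExp b p x = -(M : ℤ) →
        ¬ CentreIn b p x ∧ (classTypeList b p x).reverse = classTypeList b p x) →
    (∀ v w : ℚ × ℚ,
        ((∃ x ∈ multipoleClasses b p, classExp b p x = -(M : ℤ) ∧ v = (tauW b p x, tauV b p x)) ∨
          (∃ y, y < p ∧ 1 ≤ classPoleCount b p y ∧ classNu b p y = -(M : ℤ) + 1 ∧ v = (orbitW b p y, orbitV b p y))) →
        ((∃ x ∈ multipoleClasses b p, classExp b p x = -(M : ℤ) ∧ w = (tauW b p x, tauV b p x)) ∨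
          (∃ y, y < p ∧ 1 ≤ classPoleCount b p y ∧ classNu b p y = -(M : ℤ) + 1 ∧ w = (orbitW b p y, orbitV b p y))) →
        (v.1 * w.2 - v.2 * w.1 = 0 ∨ 1 ≤ padicValRat p (v.1 * w.2 - v.2 * w.1))) →
    casoratian b j ≠ 0 → (6 : ℤ) - 2 * M ≤ padicValRat p (casoratian b j)

/-! ## §4 The X-ray zero cells
On the θ-ranges of `RayAtlas.X1CellW3` / `X2CellP3` / `X3CellP3` (staged `HOME/lean/G9XTwoLevelCells.lean`) the hypotheses of `LawA3` hold with
`M = 10` and ONE palindromic deep type (g9 `twolevel_ray.py`, structural in `n`; g10 exact instances `n ≤ 9 / 8 / 8`: 40 / 23 / 32, all with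
criterion C2*, excess `v_p(Cas₇) − casLB ∈ {4,5,6}`), so those `−14` statements are consequences of `LawA3` (a theorem on paper) and the cell's
class-structure lemma.  Sanity `#eval` (commented; ~seconds): the class table of `bX1Ray 2` at `p = 29`.
-- #eval (List.range 29).map fun x => (x, classExp (bX1Ray 2) 29 x, classPoleCount (bX1Ray 2) 29 x, classNu (bX1Ray 2) 29 x, classTypeList (bX1Ray 2) 29 x)
-/

end Summit.KontsevichZagierPeriods.Zeta5Search.SecondOrder
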